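import Summits.BirchSwinnertonDyer.Rank1Residual.Additive.CyclotomicThreeRankOneTwistDescentData
import Summits.BirchSwinnertonDyer.Rank1Residual.Additive.XGordRankZeroOneCyclotomicThreePrep
import Summits.BirchSwinnertonDyer.Rank1Residual.Additive.GordBranchPAdicGrossZagierOdd
import Summits.BirchSwinnertonDyer.Rank1Residual.Additive.CyclotomicZpExtensionQuadratic
import Summits.BirchSwinnertonDyer.Rank1Residual.Additive.RamifiedTwistMinimality
import Literature.NumberTheory.EllipticCurves.PAdicBSDInterpolationProofs
import HarnessLib

/-!
# Sub-target (S8): the `K`-side LOWER half at `p = 3` over `K = ℚ(ζ₃)` in ranks `(r_an V, r_an W) = (0,1)` —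
# `ord₃ #Ш_an(V) + ord₃ #Ш_an(W) ≤ ord₃ #Ш(V) + ord₃ #Ш(W)` for the ADDITIVE twist `W ≅ V^{(−3)}` of analytic
# rank ONE of a good ordinary `V = E♭` of analytic rank ZERO — NO anomalous proviso (cell `b2b-bsdres`, team
# n1011, seat p16; OWNERS row T-N11-GK3LOW, sub-target (S8) dealt by the lead GEN 6, R5-26 (e))

HONEST FRAMING (cell `b2b-bsdres`, run/shared/lean/b2b/bsd-rank1-residual/, verbatim in every
file): the goal of the cell is to DELETE the COMBINATION-SHAPED residual classes of the
Birch–Swinnerton-Dyer formula for ALL analytic-rank `≤ 1` elliptic curves over `ℚ` — "full BSD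
formula for every rank `≤ 1` curve in class `C`" assembled STRICTLY from published theorems — so
that the rank-`≤ 1` remainder becomes exactly the CONSTRUCTION-SHAPED classes, which are TYPED
(missing-input `Prop`s), NOT attempted. This is not "finishing BSD". Team n1011 (N10 / N11 / O7),
seat p16: research route; labels and marks UNCHANGED; nothing booked; no Literature fact; no definition.

Theorems only. The `(0,1)` companion of `XGordRankZeroCyclotomicThreeLower` (`(0,0)`) and
`XGordRankZeroOneCyclotomicThreeLower` (`(1,0)`): the rows of route planner 3's O7-ord ∩ (G-ord, `e = 2`)@3
cell, where the ℚ-side chain (Delbourgo 2002 (B) at `3`, `ChiBranchLowerDivisibilityOddAt W 3`, p01/p12's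
`GordBranchPAdicGrossZagierOdd(Three)`) carries `hna` (the factor `ℓ ∣ 9`); over `K`, Schneider's theorem for
the GOOD ORDINARY `V_K` has the exact factor `#Ṽ(𝔽₃)[3^∞]²`, cancelling `(1 − α⁻¹)²` of `L₃(V,ω⁰,0)`.
INPUTS (explicit hypotheses; nothing asserted): per row `C • V^{(−3)} = W`, `hord`, `hadd`, ranks, a newform /
period normalisation `(f, ϖ, ϖ')` of `V`, a `3`-adic height datum `Dh` on `W(ℚ)` (intended: Delbourgo's
`⟨,⟩_{3,ℚ} := ½⟨,⟩^{Sch}_{3,K}`, J. Number Theory 95 (2002) p. 39), a twisting transport `Tr : W(ℚ) →+ V(K)`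
doubling Néron–Tate heights (EXISTS: `exists_twistTransport`), the certificate `[T¹]L₃(V,ω¹,T) ≠ 0` (`hcert`);
published, inline: `hTorK` (Kato (A) over `K`), Milne 1972, GZK, modularity; THREE TYPED INPUTS —
**`hLowK`** ((⊇/K): the two-branch main-conjecture containment for `V` over `ℚ(√−3)`, PLAN §1.2 II.3's wall,
NOT in print), **`hS1K`** (Schneider's rank-one leading term for `V_K` with the `K`-height RESTRICTING ALONG
`Tr` to `2·Dh`: the K-shape of the reading-fact `Greenberg1999.schneider_charCoeff_rankOne_quadraticBaseChange`,
whose clause `RestrictsTo` pins the height on `V(ℚ)` — torsion here — replaced by Delbourgo's definition of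
the height of `W`; true in print with `DK` = Schneider's analytic height of `V_K`, functorial for `W_K ≅ V_K`
and restricting with the factor `[K:ℚ]` (Mazur–Tate 1983; BBBM 2021 §2.2, §5); NOT discharged here), and
**`hGZ : BranchPAdicGrossZagierOddAt W 3 Dh`** (seat p01's typed `3`-adic Gross–Zagier on the odd branch).
Chain: `fE = T·qq`; (⊇/K) with `L₃(V,ω¹,T) = T·B₁` (`constantCoeff_minusBranch_eq_zero_of_analyticRank_eq_one`)
⟹ `qq(0) = h(0)ϖϖ'(1−α⁻¹)²[0]⁺_f[T¹]B⁻`; Schneider: `qq(0)·log₃γ·#V(K)[3^∞]² ∼ DK(Q,Q)·3^{v(Tam)}·#Ṽ[3^∞]²·#Ш(V_K)`;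
`Tr P_W = m•Q + t` (SOME `m`; no index lemma) ⟹ `m²DK(Q,Q) = 2Reg₃(W,Dh)`, `m²Reg(V_K) = 2Reg(W)`; GZ:
`ϖ'[T¹]B⁻log₃γ = u q_W Reg₃`; cancelling `Reg₃·#Ṽ[3^∞]²`: `ord₃ t_V + ord₃ q_W + 2ord₃ #V(K)_tors + ord₃ m² ≤
v(Tam V_K) + ord₃ #Ш(V_K)`; Milne in rank `(1,0)` (`padicVal_card_identity_rankOneZero`, the same `ord₃ m²`)
finishes. References: [GreenbergLNM1716] §4 p. 110; [Schneider1985]; [Delbourgo2002] p. 39, Thm. (B);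
[Kato2004Asterisque] Thm. 17.4; [MazurTateTeitelbaum1986Invent] §I.14; [Milne1972ArithmeticAV] §1 Thm. 1;
[BalakrishnanBesserBianchiMuller2021] §2.2, §5.
-/

noncomputable section

open scoped Classical MatrixGroups ModularForm

open CongruenceSubgroup WeierstrassCurve WeierstrassCurve.Affine.Point NumberField IsDedekindDomain
  Literature.NumberTheory.EllipticCurves Literature.NumberTheory.EllipticCurves.ModularForms
  Literature.NumberTheory.EllipticCurves.Rank1Residual
  Literature.NumberTheory.EllipticCurves.Rank1Residual.Typed
  Literature.NumberTheory.GaloisRepresentations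

namespace Summit.BirchSwinnertonDyer.Rank1Residual.Additive

section Core

variable (K : Type) [Field K] [NumberField K] [IsCyclotomicExtension {3} ℚ K]
  (V : WeierstrassCurve ℚ) [V.IsElliptic] [V.IsGloballyMinimal]
  (W : WeierstrassCurve ℚ) [W.IsElliptic] [W.IsGloballyMinimal]

/-- **Core theorem ((S8): the `K`-side LOWER half at `p = 3`, ranks `(r_an V, r_an W) = (0,1)`).** `V/ℚ`
globally minimal, good ORDINARY at `3`, `r_an(V) = 0`; `W = C • V^{(−3)}` globally minimal, ADDITIVE at `3`,
`r_an(W) = 1`; `f` the newform of `V`, `ϖ·Ω_V = Ω⁺_f`, `ϖ'·|Ω⁻(V)| = Ω⁻_f`; `Dh` a `3`-adic height datum on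
`W(ℚ)`; `Tr : W(ℚ) →+ V(K)` doubling Néron–Tate heights; the certificate `[T¹]L₃(V,ω¹,T) ≠ 0`. ASSUME
`hTorK`, **`hLowK`** ((⊇/K), NOT in print), **`hS1K`** (Schneider/K rank one, `K`-height restricting along
`Tr` to `2·Dh`) and **`hGZ : BranchPAdicGrossZagierOddAt W 3 Dh`** (seat p01's typed GZ). THEN, with Milne
1972, GZK and modularity: `#Ш_an(V) = q_V`, `#Ш_an(W) = q_W` with
**`ord₃ q_V + ord₃ q_W ≤ ord₃ #Ш(V) + ord₃ #Ш(W)`**, anomalous rows included.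
[cite: GreenbergLNM1716, §4 p. 110] [cite: Delbourgo2002, p. 39 and Theorem (B) (p. 40) (shape of the height)]
[cite: Kato2004Asterisque, Thm. 17.4 (p. 273) (torsion clause)] [cite: Milne1972ArithmeticAV, §1 Thm. 1]
[cite: MazurTateTeitelbaum1986Invent, §I.14] -/
theorem XGordRankOneZeroCyclotomicThreeLowerK.exists_padicVal_shaAn_add_le
    (hGZK : rank_eq_analyticRank_of_analyticRank_le_one) (hmod : hasEntireLFunction_rat)
    (hMilne : Milne1972.bsdQuotient_baseChange_quadratic_anyModel)
    (C : VariableChange ℚ) (hC : C • V.quadraticTwist (-(3 : ℚ)) = W)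
    (Tr : W.toAffine.Point →+ (V.baseChange K).toAffine.Point)
    (hTr : ∀ P : W.toAffine.Point, heightPairing (Tr P) (Tr P) = 2 * heightPairing P P)
    (hord : IsOrdinaryAt V 3) (hadd : Addv W 3)
    (hrV : V.analyticRank = 0) (hrW : W.analyticRank = 1)
    {N : ℕ} [NeZero N] {f : CuspForm (Gamma0 N) 2} (hf : IsNewformOf V f)
    (ϖ ϖ' : ℚ) (hϖ : (ϖ : ℝ) * V.realPeriodRat = plusPeriod f)
    (hϖ' : (ϖ' : ℝ) * V.imaginaryPeriodRat = minusPeriod f)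
    (Dh : PAdicHeightData W 3)
    (hcert : PowerSeries.coeff 1
      (padicLFunctionMinusBranch f ((unitRoot V 3 : ℤ_[3]) : ℚ_[3]) 1) ≠ 0)
    (hGZ : BranchPAdicGrossZagierOddAt W 3 Dh)
    (hTorK : ∀ (κ : ZpExtension K 3) (γ : Field.absoluteGaloisGroup K),
      κ.IsCyclotomic → κ.IsTopGenerator γ →
      (∃ ζ : ℤ_[3]ˣ, IsOfFinOrder ζ ∧
        ((GaloisRep.cyclotomicCharacter K 3 γ * ζ : ℤ_[3]ˣ) : ℤ_[3]) = (cyclotomicGenerator 3 : ℤ_[3])) →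
      ∀ D : (V.baseChange K).SelmerDualData κ γ, D.IsTorsion)
    (hLowK : ∀ (κ : ZpExtension K 3) (γ : Field.absoluteGaloisGroup K),
      κ.IsCyclotomic → κ.IsTopGenerator γ →
      (∃ ζ : ℤ_[3]ˣ, IsOfFinOrder ζ ∧
        ((GaloisRep.cyclotomicCharacter K 3 γ * ζ : ℤ_[3]ˣ) : ℤ_[3]) = (cyclotomicGenerator 3 : ℤ_[3])) →
      ∀ D : (V.baseChange K).SelmerDualData κ γ, ∀ g ∈ D.charIdeal, ∃ h : IwasawaAlgebra 3,
        iwasawaToPowerSeries 3 g =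
          iwasawaToPowerSeries 3 h *
            (PowerSeries.C ((ϖ : ℚ_[3]) * (ϖ' : ℚ_[3])) *
              (padicLFunction f ((unitRoot V 3 : ℤ_[3]) : ℚ_[3]) *
                padicLFunctionMinusBranch f ((unitRoot V 3 : ℤ_[3]) : ℚ_[3]) 1)))
    (hS1K : ∀ (κ : ZpExtension K 3) (γ : Field.absoluteGaloisGroup K),
      κ.IsCyclotomic → κ.IsTopGenerator γ →
      (∃ ζ : ℤ_[3]ˣ, IsOfFinOrder ζ ∧
        ((GaloisRep.cyclotomicCharacter K 3 γ * ζ : ℤ_[3]ˣ) : ℤ_[3]) = (cyclotomicGenerator 3 : ℤ_[3])) →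
      ∀ (D : (V.baseChange K).SelmerDualData κ γ) [Module.Finite (IwasawaAlgebra 3) D.X], D.IsTorsion →
      ∀ (fE : IwasawaAlgebra 3), D.charIdeal = Ideal.span {fE} →
        (V.baseChange K).mordellWeilRank = 1 →
        Finite (AddCommGroup.primaryComponent (V.baseChange K).sha 3) →
      ∀ (Q : (V.baseChange K).toAffine.Point), IsMordellWeilBasis (fun _ : Fin 1 => Q) →
        PowerSeries.X ∣ fE ∧
        ∃ DK : PAdicHeightDataK V 3 K,
          (∀ P P' : W.toAffine.Point, DK.pairing (Tr P) (Tr P') = 2 * Dh.pairing P P') ∧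
          ∃ u : ℤ_[3]ˣ,
            ((PowerSeries.coeff 1 fE : ℤ_[3]) : ℚ_[3]) * padicLog 3 (cyclotomicGenerator 3) *
                (Nat.card (AddCommGroup.primaryComponent (V.baseChange K).toAffine.Point 3) : ℚ_[3]) ^ 2 =
              ((u : ℤ_[3]) : ℚ_[3]) * DK.pairing Q Q *
                (3 : ℚ_[3]) ^ (padicValNat 3 (V.baseChange K).tamagawaProduct) *
                (Nat.card (AddCommGroup.primaryComponent
                  ((integralModelInt V).map (Int.castRingHom (ZMod 3))).toAffine.Point 3) : ℚ_[3]) ^ 2 *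
                (Nat.card (AddCommGroup.primaryComponent (V.baseChange K).sha 3) : ℚ_[3])) :
    ∃ qV qW : ℚ, shaAn V = (qV : ℂ) ∧ shaAn W = (qW : ℂ) ∧
      padicValRat 3 qV + padicValRat 3 qW ≤ (padicValNat 3 V.shaOrder : ℤ) + padicValNat 3 W.shaOrder := by
  classical
  have h2 : Module.finrank ℚ K = 2 := finrank_eq_two_of_isCyclotomicExtension_three (K := K)
  have hdK : (NumberField.discr K : ℚ) = -(3 : ℚ) := by rw [discr_cyclotomicThree K]; norm_num
  haveI : IsTotallyComplex K := isTotallyComplex_cyclotomicThree K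
  have hC' : C • V.quadraticTwist (NumberField.discr K : ℚ) = W := by rw [hdK]; exact hC
  have hLV : V.entireLFunction 1 ≠ 0 := (V.analyticRank_eq_zero_iff_holds (hmod V)).mp hrV
  obtain ⟨hmwV, hfinV⟩ := hGZK V (by rw [hrV]; exact zero_le_one)
  obtain ⟨hmwW, hfinW⟩ := hGZK W (by rw [hrW])
  haveI : Finite V.sha := hfinV
  haveI : Finite W.sha := hfinW
  haveI hEV : Finite V.toAffine.Point := V.finite_point_of_rank_zero (by rw [hmwV, hrV])
  have hr1W : W.mordellWeilRank = 1 := by rw [hmwW, hrW]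
  haveI : (V.baseChange K).IsElliptic := by rw [WeierstrassCurve.baseChange]; infer_instance
  haveI : Module.Finite ℤ (V.baseChange K).toAffine.Point := (V.baseChange K).module_finite_point_holds
  have hd0 : (NumberField.discr K : ℚ) ≠ 0 := by rw [hdK]; norm_num
  haveI := V.isElliptic_quadraticTwist hd0
  have htw1 : (V.quadraticTwist (NumberField.discr K : ℚ)).mordellWeilRank = 1 := by
    rw [← mordellWeilRank_variableChange_holds (V.quadraticTwist (NumberField.discr K : ℚ)) C, hC', hr1W]
  have hrK : (V.baseChange K).mordellWeilRank = 1 := by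
    rw [V.mordellWeilRank_baseChange_of_finrank_eq_two_of_finite K h2, hmwV, hrV, htw1]
  obtain ⟨hshaK, hWR⟩ := hMilne V K h2 W ⟨C, hC'⟩ (V.baseChange K) ⟨1, one_smul _ _⟩ hfinV hfinW
  haveI : Finite (V.baseChange K).sha := hshaK
  have hfinShaKp : Finite (AddCommGroup.primaryComponent (V.baseChange K).sha 3) :=
    Finite.of_injective _ Subtype.val_injective
  obtain ⟨BW, hBW⟩ := W.exists_isMordellWeilBasis_holds
  obtain ⟨BK, hBK⟩ := (V.baseChange K).exists_isMordellWeilBasis_holds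
  have hcardW : Fintype.card (Fin W.mordellWeilRank) = 1 := by rw [Fintype.card_fin, hr1W]
  have hcardK : Fintype.card (Fin (V.baseChange K).mordellWeilRank) = 1 := by rw [Fintype.card_fin, hrK]
  let kW : Fin W.mordellWeilRank := ⟨0, by omega⟩
  let kK : Fin (V.baseChange K).mordellWeilRank := ⟨0, by omega⟩
  have hP₁ : IsMordellWeilBasis (fun _ : Fin 1 => BW kW) := isMordellWeilBasis_const_of_card_eq_one hBW hcardW kW
  have hQ : IsMordellWeilBasis (fun _ : Fin 1 => BK kK) := isMordellWeilBasis_const_of_card_eq_one hBK hcardK kK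
  obtain ⟨m, t, ht, hmQ⟩ := exists_eq_zsmul_add_torsion_of_isMordellWeilBasis_one hQ (Tr (BW kW))
  obtain ⟨hM0, hm0, hvcard⟩ := padicVal_card_identity_rankOneZero K V W h2 3 (by norm_num) hC' hfinV hfinW
    hshaK hP₁ hQ Tr hTr ht hmQ hWR
  have hvM : padicValRat 3 (V.baseChange K).modifiedTamagawaProduct = padicValNat 3 (V.baseChange K).tamagawaProduct :=
    padicValRat_modifiedTamagawaProduct_baseChange V 3
      (fun hdvd ↦ V.not_hasGoodReductionAtPrime_of_dvd_minimalDiscriminantInt 3 hdvd hord.1)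
  rw [hvM] at hvcard
  have hvu : padicValRat 3 |(C.u : ℚ)| = 0 := by
    have hu : padicValRat 3 (C.u : ℚ) = 0 :=
      padicValRat_u_eq_zero_of_twist_pm_p 3 (by norm_num) V W (Or.inl hord.1) (d := -(3 : ℤ)) (Or.inr rfl) C
        (by push_cast; exact hC)
    rcases abs_choice (C.u : ℚ) with h | h
    · rw [h, hu]
    · rw [h, padicValRat.neg, hu]
  obtain ⟨κ, hκ, γ, hγ, hγ'⟩ := exists_isCyclotomic_isTopGenerator_cyclotomicThree K
  obtain ⟨D⟩ := (V.baseChange K).nonempty_selmerDualData_holds κ γ hγ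
  haveI : Module.Finite (IwasawaAlgebra 3) D.X :=
    (SelmerDualData.module_finite_of_isCyclotomic (W := V.baseChange K) (κ := κ) hκ D) hγ
  have hX : D.IsTorsion := hTorK κ γ hκ hγ hγ' D
  haveI : (Module.charIdeal (IwasawaAlgebra 3) D.X).IsPrincipal := charIdeal_isPrincipal_holds 3 D.X
  obtain ⟨fE, hchar⟩ := Submodule.IsPrincipal.principal (Module.charIdeal (IwasawaAlgebra 3) D.X)
  have hchar' : D.charIdeal = Ideal.span {fE} := hchar
  have hfEmem : fE ∈ D.charIdeal := by rw [hchar']; exact Ideal.mem_span_singleton_self fE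
  obtain ⟨h, hιfE⟩ := hLowK κ γ hκ hγ hγ' D fE hfEmem
  obtain ⟨⟨qq, hqq⟩, DK, hres, u₁, hu₁⟩ := hS1K κ γ hκ hγ hγ' D hX fE hchar' hrK hfinShaKp (BK kK) hQ
  have hRegp : padicRegulator Dh = Dh.pairing (BW kW) (BW kW) := by
    rw [← padicRegulatorOf_eq_padicRegulator_holds Dh hBW, padicRegulatorOf]
    convert Matrix.det_eq_elem_of_card_eq_one (A := Dh.pairingMatrix BW) hcardW kW
    rfl
  have hDKQ : (m : ℚ_[3]) ^ 2 * DK.pairing (BK kK) (BK kK) = 2 * padicRegulator Dh := by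
    rw [hRegp]; exact padicHeightK_twistGenerator_eq K V W DK Dh Tr hres ht hmQ
  set sV : ℚ := ratPlusSymbol f 0 with hsV
  set tV : ℚ := ϖ * sV with htV
  have hΩV : (V.realPeriodRat : ℂ) ≠ 0 := by exact_mod_cast V.realPeriodRat_pos_holds.ne'
  have hLvalV : V.entireLFunction 1 = (((sV : ℝ) * plusPeriod f : ℝ) : ℂ) := hf.entireLFunction_one_eq
  have hqV' : V.entireLFunction 1 / (V.realPeriodRat : ℂ) = ((tV : ℚ) : ℂ) := by
    rw [hLvalV, ← hϖ, div_eq_iff hΩV, htV]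
    push_cast
    ring
  have htV0 : tV ≠ 0 := by
    intro h0
    apply hLV
    rw [(div_eq_iff hΩV).mp hqV', h0]; simp
  obtain ⟨-, -, -, hshaV⟩ := Wuthrich2014.shaAn_eq_of_L_one_div_eq hGZK V hLV hqV'
  have hordG : GoodOrd V 3 := ⟨hord.1, hord.2⟩
  have hVW : ∃ C : VariableChange ℚ, C • V.quadraticTwist (-((3 : ℕ) : ℚ)) = W :=
    ⟨C, by have h := hC; norm_num at h ⊢; exact h⟩
  obtain ⟨u, qW, hlead, hpgz⟩ := hGZ V (by norm_num) hVW hordG hf ϖ' hϖ'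
  have h32 : (3 / 2 : ℕ) = 1 := by norm_num
  rw [hr1W, pow_one, h32] at hpgz
  have hB0 : PowerSeries.constantCoeff
      (padicLFunctionMinusBranch f ((unitRoot V 3 : ℤ_[3]) : ℚ_[3]) 1) = 0 := by
    have h := constantCoeff_minusBranch_eq_zero_of_analyticRank_eq_one W 3 hmod hadd hrW (by norm_num) V hVW
      hordG hf ϖ' hϖ'
    rwa [h32] at h
  have hϖ'0 : ϖ' ≠ 0 := by
    rintro rfl
    have hper : 0 < minusPeriod f := IsNewform0.minusPeriod_pos_holds hf.1 hf.coeffField_eq_bot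
    rw [← hϖ', Rat.cast_zero, zero_mul] at hper
    exact lt_irrefl _ hper
  have hΩW : (W.realPeriodRat : ℂ) ≠ 0 := by exact_mod_cast W.realPeriodRat_pos_holds.ne'
  have hRegW : (W.regulator : ℂ) ≠ 0 := by exact_mod_cast (regulator_pos_holds W).ne'
  have htamW : (W.tamagawaProduct : ℂ) ≠ 0 := by exact_mod_cast W.tamagawaProduct_pos_holds.ne'
  have hshaW : shaAn W = ((qW * (W.torsionOrder : ℚ) ^ 2 / (W.tamagawaProduct : ℚ) : ℚ) : ℂ) := by
    rw [shaAn_def, hlead]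
    push_cast
    field_simp
  set a : ℚ_[3] := ((unitRoot V 3 : ℤ_[3]) : ℚ_[3]) with ha
  set B := padicLFunctionMinusBranch f a 1 with hBdef
  obtain ⟨B₁, hB₁⟩ := PowerSeries.X_dvd_iff.mpr hB0
  have hB₁' : B = PowerSeries.X ^ 1 * B₁ := by rw [pow_one]; exact hB₁
  have hAeq : PowerSeries.coeff 1 B = PowerSeries.constantCoeff B₁ := by
    rw [hB₁', PowerSeries.coeff_X_pow_mul', if_pos le_rfl, Nat.sub_self, PowerSeries.coeff_zero_eq_constantCoeff]
  have hqq1 : fE = PowerSeries.X ^ 1 * qq := by rw [pow_one]; exact hqq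
  have hcoeff_fE : (PowerSeries.coeff 1 fE : ℤ_[3]) = PowerSeries.constantCoeff qq := by
    rw [hqq1, PowerSeries.coeff_X_pow_mul', if_pos le_rfl, Nat.sub_self, PowerSeries.coeff_zero_eq_constantCoeff]
  have hL0 : PowerSeries.constantCoeff (padicLFunction f a) = (1 - a⁻¹) ^ 2 * (sV : ℚ_[3]) := by
    rw [ha]
    exact constantCoeff_padicLFunction_unitRoot hord hf
  have hcoeff_ιfE : ((PowerSeries.coeff 1 fE : ℤ_[3]) : ℚ_[3]) =
      ((PowerSeries.constantCoeff h : ℤ_[3]) : ℚ_[3]) * ((ϖ : ℚ_[3]) * (ϖ' : ℚ_[3])) *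
        ((1 - a⁻¹) ^ 2 * (sV : ℚ_[3]) * PowerSeries.coeff 1 B) := by
    rw [← Wuthrich2014.coeff_iwasawaToPowerSeries 3 fE 1, hιfE, hAeq, hB₁',
      show iwasawaToPowerSeries 3 h * (PowerSeries.C ((ϖ : ℚ_[3]) * (ϖ' : ℚ_[3])) *
          (padicLFunction f a * (PowerSeries.X ^ 1 * B₁))) =
        PowerSeries.X ^ 1 * (iwasawaToPowerSeries 3 h * PowerSeries.C ((ϖ : ℚ_[3]) * (ϖ' : ℚ_[3])) *
          (padicLFunction f a * B₁)) by ring,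
      PowerSeries.coeff_X_pow_mul', if_pos le_rfl, Nat.sub_self, PowerSeries.coeff_zero_eq_constantCoeff]
    simp only [map_mul, PowerSeries.constantCoeff_C, constantCoeff_iwasawaToPowerSeries, hL0]
  set h0 : ℚ_[3] := ((PowerSeries.constantCoeff h : ℤ_[3]) : ℚ_[3]) with hh0
  set qq0 : ℚ_[3] := ((PowerSeries.constantCoeff qq : ℤ_[3]) : ℚ_[3]) with hqq0
  set A : ℚ_[3] := PowerSeries.coeff 1 B with hA
  set lg : ℚ_[3] := padicLog 3 (cyclotomicGenerator 3) with hlg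
  set TK : ℚ_[3] := (Nat.card (AddCommGroup.primaryComponent (V.baseChange K).toAffine.Point 3) : ℚ_[3]) with hTK
  set Np : ℚ_[3] := (Nat.card (AddCommGroup.primaryComponent
    ((integralModelInt V).map (Int.castRingHom (ZMod 3))).toAffine.Point 3) : ℚ_[3]) with hNp
  set ShK : ℚ_[3] := (Nat.card (AddCommGroup.primaryComponent (V.baseChange K).sha 3) : ℚ_[3]) with hShK
  set DKQ : ℚ_[3] := DK.pairing (BK kK) (BK kK) with hDKQdef
  set Rg : ℚ_[3] := padicRegulator Dh with hRg
  set vK : ℕ := padicValNat 3 (V.baseChange K).tamagawaProduct with hvK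
  have hi : qq0 = h0 * ((ϖ : ℚ_[3]) * (ϖ' : ℚ_[3])) * ((1 - a⁻¹) ^ 2 * (sV : ℚ_[3]) * A) := by
    rw [hqq0, ← hcoeff_fE]; exact hcoeff_ιfE
  have hii : qq0 * lg * TK ^ 2 = ((u₁ : ℤ_[3]) : ℚ_[3]) * DKQ * (3 : ℚ_[3]) ^ vK * Np ^ 2 * ShK := by
    rw [hqq0, ← hcoeff_fE]; exact hu₁
  have hiii : (ϖ' : ℚ_[3]) * A * lg = ((u : ℤ_[3]) : ℚ_[3]) * (qW : ℚ_[3]) * Rg := by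
    exact_mod_cast hpgz
  have hiv : (m : ℚ_[3]) ^ 2 * DKQ = 2 * Rg := hDKQ
  obtain ⟨-, hunit⟩ := unitRoot_spec_holds V 3 hord
  obtain ⟨ua, hua⟩ := hunit
  have haU : a = ((ua : ℤ_[3]) : ℚ_[3]) := by rw [ha, hua]
  have ha0 : a ≠ 0 := by rw [haU]; exact coe_units_ne_zero 3 ua
  obtain ⟨u₂, hu₂⟩ := exists_unit_one_sub_unitRoot_inv 3 V hord
  obtain ⟨u₃, hu₃⟩ := exists_unit_natCard_eq_mul_card_primaryComponent
    ((integralModelInt V).map (Int.castRingHom (ZMod 3))).toAffine.Point 3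
  have hNcount : (V.reductionPointCount 3 : ℚ_[3]) = ((u₃ : ℤ_[3]) : ℚ_[3]) * Np := by
    rw [WeierstrassCurve.reductionPointCount, hNp]
    exact hu₃
  have hNp0 : Np ≠ 0 := by rw [hNp]; exact_mod_cast Nat.card_pos.ne'
  have h1 : (1 - a⁻¹) = ((u₂ : ℤ_[3]) : ℚ_[3]) * ((u₃ : ℤ_[3]) : ℚ_[3]) * Np := by
    rw [ha, hu₂, hNcount, mul_assoc]
  obtain ⟨ul, hul⟩ := exists_unit_padicLog_cyclotomicGenerator 3 (by norm_num)
  have hlg0 : lg ≠ 0 := by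
    rw [hlg, hul]; exact mul_ne_zero (by norm_num) (coe_units_ne_zero 3 ul)
  have hA0 : A ≠ 0 := hcert
  obtain ⟨uT, huT⟩ := exists_unit_torsionOrder_eq (V.baseChange K) 3
  have hTK0 : TK ≠ 0 := by
    intro h0'
    rw [hTK] at h0'
    have h1' : ((V.baseChange K).torsionOrder : ℚ_[3]) = 0 := by rw [huT, h0', mul_zero]
    exact ((V.baseChange K).torsionOrder_pos (V.baseChange K).finite_torsion_holds).ne' (by exact_mod_cast h1')
  have hShK0 : ShK ≠ 0 := by rw [hShK]; exact_mod_cast Nat.card_pos.ne'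
  have hp0 : (3 : ℚ_[3]) ≠ 0 := by exact_mod_cast (by norm_num : (3 : ℕ) ≠ 0)
  have hmQ0 : (m : ℚ_[3]) ≠ 0 := by exact_mod_cast hm0
  have hϖ'Q : (ϖ' : ℚ_[3]) ≠ 0 := by exact_mod_cast hϖ'0
  have htVQ : (tV : ℚ_[3]) ≠ 0 := by exact_mod_cast htV0
  have hLHS0 : (ϖ' : ℚ_[3]) * A * lg ≠ 0 := mul_ne_zero (mul_ne_zero hϖ'Q hA0) hlg0
  have hRg0 : Rg ≠ 0 := fun h0' ↦ hLHS0 (by rw [hiii, h0', mul_zero])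
  have hqWQ : (qW : ℚ_[3]) ≠ 0 := fun h0' ↦ hLHS0 (by rw [hiii, h0', mul_zero, zero_mul])
  have hqW0 : qW ≠ 0 := fun h0' ↦ hqWQ (by rw [h0']; push_cast; rfl)
  have hh0val : 0 ≤ h0.valuation := by rw [hh0]; exact PadicInt.valuation_coe_nonneg
  set UU : ℚ_[3] := ((u : ℤ_[3]) : ℚ_[3]) * (((u₂ : ℤ_[3]) : ℚ_[3]) * ((u₃ : ℤ_[3]) : ℚ_[3])) ^ 2 with hUU
  have hU0 : UU ≠ 0 :=
    mul_ne_zero (coe_units_ne_zero 3 u)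
      (pow_ne_zero 2 (mul_ne_zero (coe_units_ne_zero 3 u₂) (coe_units_ne_zero 3 u₃)))
  have key : h0 * UU * (((tV : ℚ_[3]) * (qW : ℚ_[3])) * TK ^ 2 * (m : ℚ_[3]) ^ 2) =
      2 * ((u₁ : ℤ_[3]) : ℚ_[3]) * (3 : ℚ_[3]) ^ vK * ShK := by
    apply mul_right_cancel₀ (mul_ne_zero hRg0 (pow_ne_zero 2 hNp0))
    have e1 : 2 * ((u₁ : ℤ_[3]) : ℚ_[3]) * (3 : ℚ_[3]) ^ vK * ShK * (Rg * Np ^ 2) =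
        ((m : ℚ_[3]) ^ 2 * DKQ) * ((u₁ : ℤ_[3]) : ℚ_[3]) * (3 : ℚ_[3]) ^ vK * Np ^ 2 * ShK := by
      rw [hiv]; ring
    have e2 : ((m : ℚ_[3]) ^ 2 * DKQ) * ((u₁ : ℤ_[3]) : ℚ_[3]) * (3 : ℚ_[3]) ^ vK * Np ^ 2 * ShK =
        (m : ℚ_[3]) ^ 2 * (qq0 * lg * TK ^ 2) := by
      rw [hii]; ring
    have e3 : (m : ℚ_[3]) ^ 2 * (qq0 * lg * TK ^ 2) =
        (m : ℚ_[3]) ^ 2 * (h0 * (ϖ : ℚ_[3]) * ((1 - a⁻¹) ^ 2 * (sV : ℚ_[3])) *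
          ((ϖ' : ℚ_[3]) * A * lg) * TK ^ 2) := by
      rw [hi]; ring
    rw [e1, e2, e3, hiii, h1, hUU, htV]
    push_cast
    ring
  have hvU : UU.valuation = 0 := by
    rw [hUU, Padic.valuation_mul (coe_units_ne_zero 3 u)
      (pow_ne_zero 2 (mul_ne_zero (coe_units_ne_zero 3 u₂) (coe_units_ne_zero 3 u₃))),
      Padic.valuation_pow, Padic.valuation_mul (coe_units_ne_zero 3 u₂) (coe_units_ne_zero 3 u₃),
      valuation_coe_units_eq_zero, valuation_coe_units_eq_zero, valuation_coe_units_eq_zero]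
    ring
  have htq0 : (tV : ℚ_[3]) * (qW : ℚ_[3]) ≠ 0 := mul_ne_zero htVQ hqWQ
  have hprod0 : ((tV : ℚ_[3]) * (qW : ℚ_[3])) * TK ^ 2 * (m : ℚ_[3]) ^ 2 ≠ 0 :=
    mul_ne_zero (mul_ne_zero htq0 (pow_ne_zero 2 hTK0)) (pow_ne_zero 2 hmQ0)
  have hRHS0 : 2 * ((u₁ : ℤ_[3]) : ℚ_[3]) * (3 : ℚ_[3]) ^ vK * ShK ≠ 0 :=
    mul_ne_zero (mul_ne_zero (mul_ne_zero two_ne_zero (coe_units_ne_zero 3 u₁)) (pow_ne_zero _ hp0)) hShK0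
  have hh0ne : h0 ≠ 0 := fun h0' ↦ hRHS0 (by rw [← key, h0', zero_mul, zero_mul])
  have hval := congrArg Padic.valuation key
  rw [Padic.valuation_mul (mul_ne_zero hh0ne hU0) hprod0, Padic.valuation_mul hh0ne hU0, hvU,
    Padic.valuation_mul (mul_ne_zero htq0 (pow_ne_zero 2 hTK0)) (pow_ne_zero 2 hmQ0),
    Padic.valuation_mul htq0 (pow_ne_zero 2 hTK0), Padic.valuation_mul htVQ hqWQ,
    Padic.valuation_pow, Padic.valuation_pow,
    Padic.valuation_mul (mul_ne_zero (mul_ne_zero two_ne_zero (coe_units_ne_zero 3 u₁)) (pow_ne_zero _ hp0))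
      hShK0,
    Padic.valuation_mul (mul_ne_zero two_ne_zero (coe_units_ne_zero 3 u₁)) (pow_ne_zero _ hp0),
    Padic.valuation_mul two_ne_zero (coe_units_ne_zero 3 u₁), valuation_coe_units_eq_zero,
    Padic.valuation_pow] at hval
  have hv3 : (3 : ℚ_[3]).valuation = 1 := by exact_mod_cast Padic.valuation_p (p := 3)
  have hv2 : (2 : ℚ_[3]).valuation = 0 := by
    have h : ((2 : ℚ) : ℚ_[3]).valuation = padicValRat 3 (2 : ℚ) := Padic.valuation_ratCast 2
    rw [show padicValRat 3 (2 : ℚ) = 0 by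
      rw [show (2 : ℚ) = ((2 : ℕ) : ℚ) by norm_num, padicValRat.of_nat]; norm_num [padicValNat.eq_zero_of_not_dvd]] at h
    exact_mod_cast h
  rw [hv3, hv2] at hval
  have hvTK : TK.valuation = (padicValNat 3 (V.baseChange K).torsionOrder : ℤ) := by
    have h := congrArg Padic.valuation huT
    rw [Padic.valuation_natCast, Padic.valuation_mul (coe_units_ne_zero 3 uT) hTK0,
      valuation_coe_units_eq_zero, zero_add] at h
    exact h.symm
  have hvShK : ShK.valuation = (padicValNat 3 (V.baseChange K).shaOrder : ℤ) := by
    rw [hShK, Padic.valuation_natCast, padicValNat_card_addPrimaryComponent 3]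
    rfl
  have hvm : (m : ℚ_[3]).valuation = padicValRat 3 (m : ℚ) := by
    rw [show (m : ℚ_[3]) = ((m : ℚ) : ℚ_[3]) by push_cast; rfl, Padic.valuation_ratCast]
  have hvtV : (tV : ℚ_[3]).valuation = padicValRat 3 tV := Padic.valuation_ratCast tV
  have hvqW : (qW : ℚ_[3]).valuation = padicValRat 3 qW := Padic.valuation_ratCast qW
  rw [hvTK, hvShK, hvm, hvtV, hvqW] at hval
  have hI : padicValRat 3 tV + padicValRat 3 qW + 2 * padicValNat 3 (V.baseChange K).torsionOrder +
      2 * padicValRat 3 (m : ℚ) ≤ (vK : ℤ) + padicValNat 3 (V.baseChange K).shaOrder := by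
    simp only [Nat.cast_ofNat] at hval
    linarith
  have hcV0 : (V.tamagawaProduct : ℚ) ≠ 0 := by exact_mod_cast V.tamagawaProduct_pos_holds.ne'
  have hcW0 : (W.tamagawaProduct : ℚ) ≠ 0 := by exact_mod_cast W.tamagawaProduct_pos_holds.ne'
  have hNV0 : ((Nat.card V.toAffine.Point : ℕ) : ℚ) ≠ 0 := by exact_mod_cast Nat.card_pos.ne'
  have hNW0 : (W.torsionOrder : ℚ) ≠ 0 := by exact_mod_cast (W.torsionOrder_pos W.finite_torsion_holds).ne'
  refine ⟨tV * (Nat.card V.toAffine.Point : ℚ) ^ 2 / (V.tamagawaProduct : ℚ),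
    qW * (W.torsionOrder : ℚ) ^ 2 / (W.tamagawaProduct : ℚ), hshaV, hshaW, ?_⟩
  rw [padicValRat.div (mul_ne_zero htV0 (pow_ne_zero 2 hNV0)) hcV0,
    padicValRat.mul htV0 (pow_ne_zero 2 hNV0), padicValRat.pow, padicValRat.of_nat, padicValRat.of_nat,
    padicValRat.div (mul_ne_zero hqW0 (pow_ne_zero 2 hNW0)) hcW0,
    padicValRat.mul hqW0 (pow_ne_zero 2 hNW0), padicValRat.pow, padicValRat.of_nat, padicValRat.of_nat]
  rw [hvu] at hvcard
  push_cast at hI hvcard ⊢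
  linarith

end Core

end Summit.BirchSwinnertonDyer.Rank1Residual.Additive

end
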